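import Literature.NumberTheory.Automorphic.ArchLocalTorusOrbitalCompactWallContinuity   -- ★ p839989∕p839953 (C-cw): block properness, `integrable_…_of_blocks`, `isOpen_setOf_blockSeparated`
import Literature.NumberTheory.Automorphic.ArchTorusOneAngleCurve                     -- ★ (V4) p838246: `hasDerivAt_coe_torusCurve`, `continuous_torusCurve`
import Mathlib.Analysis.Matrix.Normed
import Mathlib.Analysis.Calculus.ParametricIntegral
import Mathlib.Analysis.Calculus.ContDiff.Deriv
import HarnessLib

/-!
# The per-place torus orbital function of `G_w = U(σ_w diag α)(ℂ)` is `C¹` along one-angle curves on the BLOCK-SEPARATED set — through compact walls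
# (ROAD-Sd census bricks (B4) + (J-cw) part 1; Rogawski 1990 §8.2 pp. 122–123; the per-place twin of ★ `ArchTorusOrbitalDeriv`, generalised to blocks)

Topic `NumberTheory/Automorphic`; namespace `Literature.NumberTheory.Automorphic.UnitaryGroup`.  THEOREMS ONLY (no `def`, no instance, no notation, no axiom, no named
fact, no `sorry`).  Cell `pub/hodgecm-mathlib`, ENGINE T1 (crux H413 = `stmt-HodgeConjecture-24833`); floor-1 preparation, count-neutral, under books rows #111 (S-d) ∕ #88
(ST-∞): ROAD-Sd map of record `CENSUS-ROAD-Sd-letters` (3ec10e9b) bricks (B4) «per-place twin of p839771» and (J-cw) «`C¹` across a compact wall» (LEAD DESK WORD T8-15 (C),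
F0P3a-plan (g9), 2026-09-01); author F0P3a-p06 (g10); per place (desk ruling T6-84 (V7)).  PATTERN: ★ `ArchTorusOrbitalDeriv` (p839771, F0P3a-p07 (g6): GLOBAL `arch`,
REGULAR set) re-cut on `archLocal L N (diagonal α) w ≤ GL_N(ℂ)` with the domination supplied by ★ (C-cw) `isCompact_setOf_exists_conj_circleDiagonal_mem_of_blocks`
(p839953): the parameter may cross walls INSIDE constant-sign blocks of a labelling `b : Fin N → ι` (`b` injective = the regular set; `N = 3`, `b = (0,1,0)`, `e_0 e_2 > 0` =
the compact wall of `U(2,1)`, print's `γ₂ → γ₀′`).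

SETTING.  `G_w = archLocal L N (diagonal α) w`, `α_i ≠ 0`, `σ_w(α_i)` real (`hreal`); torus point `t_w(z) = ⟨circleDiagonal N z, _⟩`; TEST FUNCTIONS in the ambient-smooth
currency AT ONE PLACE: `Θ : M_N(ℂ) → E`, `ContDiff ℝ 1 Θ` for the `L^∞`-operator norm (`open scoped Matrix.Norms.Operator`, the `ArchimedeanCalculus` convention), read on `G_w`
as `k ↦ Θ ↑↑k`, with compact support there; THE CURVE `z_ψ = (z₀_i · e^{i c_i ψ})_i` (★ (V4)), `T(ψ) = diag(z_ψ)` with tangent `diag(d′(ψ))`,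
`d′(ψ)_i = z₀_i · e^{i c_i ψ} · i c_i` (★ `hasDerivAt_coe_torusCurve`).

WHAT IS PROVED.
* §1 `hasDerivAt_coe_circleDiagonal_curve`, `coe_conj_archLocal`, `hasDerivAt_apply_conj_circleDiagonal_curve` (chain rule along `g·T(ψ)·g⁻¹`),
  `fderiv_apply_conj_circleDiagonal_curve_eq_zero` (the derivative term vanishes off `tsupport`), `continuous_fderiv_apply_conj_circleDiagonal_curve` (joint continuity).
* §2 (labelling `b`, `hsign`: distinct same-label coordinates have weights of the same sign) `exists_closedBall_isCompact_fderiv_apply_conj_circleDiagonal_curve_eq_zero_of_blocks`;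
  **`hasDerivAt_integral_comp_conj_circleDiagonal_curve_of_blocks`** — at every `ψ₀` with `z_{ψ₀}` BLOCK-SEPARATED:
  `d∕dψ|_{ψ₀} ∫_{G_w} Θ(↑↑(g·t_w(z_ψ)·g⁻¹)) dν = ∫_{G_w} DΘ(↑↑(g·t_w(z_{ψ₀})·g⁻¹))[↑g·diag d′(ψ₀)·↑g⁻¹] dν` (Mathlib `hasDerivAt_integral_of_dominated_loc_of_deriv_le`);
  `continuousOn_integral_fderiv_apply_conj_circleDiagonal_curve_of_blocks`, `deriv_integral_comp_conj_circleDiagonal_curve_of_blocks`,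
  **`contDiffOn_one_integral_comp_conj_circleDiagonal_curve_of_blocks`** — `C¹` on the open set `{ψ | z_ψ block-separated}` (for `b = (0,1,0)` on `U(2,1)`: THROUGH the
  compact wall `z_0 = z_2`).
NOT HERE: evenness across the wall and the limit `∂_ψ(2 sin ψ · F) → 2F(z₀)` ((J-cw) part 2, next file); noncompact walls (LETTER (J-nc)); `C^∞`.  HONEST LABEL: real analysis on
a real group; HC_CM is proved only modulo the printed citations until rung 0 closes, and this file pays nothing by itself.

## References
* [Rogawski1990] J. D. Rogawski, *Automorphic Representations of Unitary Groups in Three Variables*, Ann. of Math. Stud. 123 (1990), §8.2 pp. 122–123 (the limit formulas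
  differentiate `ψ ↦ Φ(γ(ψ), f)`; through `γ₀′` with compact centraliser the orbital integral is smooth), §3.1 p. 19.
* [Shelstad1979] D. Shelstad, *Characters and inner forms of a quasi-split group over ℝ*, Compositio Math. 39 (1979), §4.
* [Folland1995] G. B. Folland, *A Course in Abstract Harmonic Analysis* (1995), §2.6 (differentiation under the integral sign).
* [DeitmarEchterhoff2014] A. Deitmar, S. Echterhoff, *Principles of Harmonic Analysis*, 2nd ed. (2014), Lemma 9.3.3.
-/

set_option autoImplicit false

noncomputable section

open MeasureTheory Measure NumberField NumberField.InfinitePlace Filter Topology Set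
open scoped Matrix MatrixGroups Real Classical
open scoped Matrix.Norms.Operator

namespace Literature.NumberTheory.Automorphic.UnitaryGroup

variable (L : Type) [Field L] (N : ℕ) (α : Fin N → L) (w : {w : InfinitePlace L // IsComplex w})

/-! ## §1 The curve in `M_N(ℂ)` and the chain rule -/

/-- **`ψ ↦ diag(z_ψ)` has derivative `diag(d′(ψ))` in `M_N(ℂ)`** (★ `coe_circleDiagonal`; entrywise ★ `hasDerivAt_coe_torusCurve`). [cite: Rogawski1990, §8.2 p. 123] -/
theorem hasDerivAt_coe_circleDiagonal_curve (z₀ : Fin N → Circle) (c : Fin N → ℝ) (ψ : ℝ) :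
    HasDerivAt (fun ψ : ℝ => ((circleDiagonal N fun i => z₀ i * Circle.exp (c i * ψ) : GL (Fin N) ℂ) : Matrix (Fin N) (Fin N) ℂ))
      (Matrix.diagonal fun i => (z₀ i : ℂ) * (Complex.exp ((c i * ψ : ℝ) * Complex.I) * ((c i : ℂ) * Complex.I))) ψ := by
  have hd : HasDerivAt (fun ψ : ℝ => fun i : Fin N => ((z₀ i * Circle.exp (c i * ψ) : Circle) : ℂ))
      (fun i => (z₀ i : ℂ) * (Complex.exp ((c i * ψ : ℝ) * Complex.I) * ((c i : ℂ) * Complex.I))) ψ :=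
    hasDerivAt_pi.2 fun i => hasDerivAt_coe_torusCurve z₀ c i ψ
  let D : (Fin N → ℂ) →L[ℝ] Matrix (Fin N) (Fin N) ℂ := LinearMap.toContinuousLinearMap (Matrix.diagonalLinearMap (Fin N) ℝ ℂ)
  have hD : ∀ d : Fin N → ℂ, D d = Matrix.diagonal d := fun _ => rfl
  have hfun : (fun ψ : ℝ => ((circleDiagonal N fun i => z₀ i * Circle.exp (c i * ψ) : GL (Fin N) ℂ) : Matrix (Fin N) (Fin N) ℂ)) =
      fun ψ => D fun i : Fin N => ((z₀ i * Circle.exp (c i * ψ) : Circle) : ℂ) := by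
    funext ψ
    rw [coe_circleDiagonal, hD]
  rw [hfun, ← hD]
  exact D.hasFDerivAt.comp_hasDerivAt ψ hd

/-- `↑↑(g · t · g⁻¹) = ↑g · ↑t · ↑g⁻¹` in `M_N(ℂ)`. [cite: Rogawski1990, §3.1 p. 19] -/
theorem coe_conj_archLocal (H : Matrix (Fin N) (Fin N) L) (g t : archLocal L N H w) :
    (((g * t * g⁻¹ : archLocal L N H w) : GL (Fin N) ℂ) : Matrix (Fin N) (Fin N) ℂ) =
      ((g : GL (Fin N) ℂ) : Matrix (Fin N) (Fin N) ℂ) * ((t : GL (Fin N) ℂ) : Matrix (Fin N) (Fin N) ℂ) *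
        (((g⁻¹ : archLocal L N H w) : GL (Fin N) ℂ) : Matrix (Fin N) (Fin N) ℂ) := by
  rw [Subgroup.coe_mul, Subgroup.coe_mul, Units.val_mul, Units.val_mul]

variable {E : Type*} [NormedAddCommGroup E] [NormedSpace ℝ E]

/-- **Chain rule along the conjugated curve**: for `Θ` `C¹` on `M_N(ℂ)` and `g ∈ G_w`, `ψ ↦ Θ(↑g · diag(z_ψ) · ↑g⁻¹)` has derivative `DΘ(…)[↑g · diag(d′(ψ)) · ↑g⁻¹]`.
[cite: Rogawski1990, §8.2 p. 123] [cite: Folland1995, §2.6] -/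
theorem hasDerivAt_apply_conj_circleDiagonal_curve (Θ : Matrix (Fin N) (Fin N) ℂ → E) (hΘ : ContDiff ℝ 1 Θ)
    (z₀ : Fin N → Circle) (c : Fin N → ℝ) (g : archLocal L N (Matrix.diagonal α) w) (ψ : ℝ) :
    HasDerivAt (fun ψ : ℝ => Θ ((((g * ⟨circleDiagonal N fun i => z₀ i * Circle.exp (c i * ψ),
        circleDiagonal_mem_archLocal_diagonal L N α w _⟩ * g⁻¹ : archLocal L N (Matrix.diagonal α) w) : GL (Fin N) ℂ) : Matrix (Fin N) (Fin N) ℂ)))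
      (fderiv ℝ Θ ((((g * ⟨circleDiagonal N fun i => z₀ i * Circle.exp (c i * ψ), circleDiagonal_mem_archLocal_diagonal L N α w _⟩ * g⁻¹ :
          archLocal L N (Matrix.diagonal α) w) : GL (Fin N) ℂ) : Matrix (Fin N) (Fin N) ℂ))
        (((g : GL (Fin N) ℂ) : Matrix (Fin N) (Fin N) ℂ) * (Matrix.diagonal fun i => (z₀ i : ℂ) * (Complex.exp ((c i * ψ : ℝ) * Complex.I) * ((c i : ℂ) * Complex.I))) *
          (((g⁻¹ : archLocal L N (Matrix.diagonal α) w) : GL (Fin N) ℂ) : Matrix (Fin N) (Fin N) ℂ))) ψ := by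
  have h1 := ((hasDerivAt_coe_circleDiagonal_curve N z₀ c ψ).const_mul (((g : GL (Fin N) ℂ) : Matrix (Fin N) (Fin N) ℂ))).mul_const
    (((g⁻¹ : archLocal L N (Matrix.diagonal α) w) : GL (Fin N) ℂ) : Matrix (Fin N) (Fin N) ℂ)
  simp_rw [coe_conj_archLocal]
  exact ((hΘ.differentiable one_ne_zero) _).hasFDerivAt.comp_hasDerivAt ψ h1

/-- **Off the support the derivative term vanishes**: if `g · t_w(z_ψ) · g⁻¹ ∉ tsupport (Θ ∘ ↑↑·)` then `DΘ(↑↑(g·t_w(z_ψ)·g⁻¹))[↑g · diag d′(ψ) · ↑g⁻¹] = 0`.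
[cite: Folland1995, §2.6] [cite: Rogawski1990, §8.2 p. 123] -/
theorem fderiv_apply_conj_circleDiagonal_curve_eq_zero (Θ : Matrix (Fin N) (Fin N) ℂ → E) (hΘ : ContDiff ℝ 1 Θ)
    (z₀ : Fin N → Circle) (c : Fin N → ℝ) (g : archLocal L N (Matrix.diagonal α) w) (ψ : ℝ)
    (hg : g * ⟨circleDiagonal N fun i => z₀ i * Circle.exp (c i * ψ), circleDiagonal_mem_archLocal_diagonal L N α w _⟩ * g⁻¹ ∉
      tsupport fun k : archLocal L N (Matrix.diagonal α) w => Θ (((k : GL (Fin N) ℂ) : Matrix (Fin N) (Fin N) ℂ))) :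
    fderiv ℝ Θ ((((g * ⟨circleDiagonal N fun i => z₀ i * Circle.exp (c i * ψ), circleDiagonal_mem_archLocal_diagonal L N α w _⟩ * g⁻¹ :
          archLocal L N (Matrix.diagonal α) w) : GL (Fin N) ℂ) : Matrix (Fin N) (Fin N) ℂ))
        (((g : GL (Fin N) ℂ) : Matrix (Fin N) (Fin N) ℂ) * (Matrix.diagonal fun i => (z₀ i : ℂ) * (Complex.exp ((c i * ψ : ℝ) * Complex.I) * ((c i : ℂ) * Complex.I))) *
          (((g⁻¹ : archLocal L N (Matrix.diagonal α) w) : GL (Fin N) ℂ) : Matrix (Fin N) (Fin N) ℂ)) = 0 := by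
  have hev : (fun k : archLocal L N (Matrix.diagonal α) w => Θ (((k : GL (Fin N) ℂ) : Matrix (Fin N) (Fin N) ℂ))) =ᶠ[𝓝 (g *
      ⟨circleDiagonal N fun i => z₀ i * Circle.exp (c i * ψ), circleDiagonal_mem_archLocal_diagonal L N α w _⟩ * g⁻¹)] 0 :=
    notMem_tsupport_iff_eventuallyEq.1 hg
  have ht : Continuous fun ψ' : ℝ => (⟨circleDiagonal N fun i => z₀ i * Circle.exp (c i * ψ'), circleDiagonal_mem_archLocal_diagonal L N α w _⟩ :
      archLocal L N (Matrix.diagonal α) w) :=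
    ((continuous_circleDiagonal N).comp (continuous_torusCurve z₀ c)).subtype_mk _
  have hcurve : ContinuousAt (fun ψ' : ℝ => g * ⟨circleDiagonal N fun i => z₀ i * Circle.exp (c i * ψ'), circleDiagonal_mem_archLocal_diagonal L N α w _⟩ * g⁻¹) ψ :=
    ((continuous_const.mul ht).mul continuous_const).continuousAt
  have hev' : (fun ψ' : ℝ => Θ ((((g * ⟨circleDiagonal N fun i => z₀ i * Circle.exp (c i * ψ'), circleDiagonal_mem_archLocal_diagonal L N α w _⟩ * g⁻¹ :
      archLocal L N (Matrix.diagonal α) w) : GL (Fin N) ℂ) : Matrix (Fin N) (Fin N) ℂ))) =ᶠ[𝓝 ψ] fun _ => 0 := by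
    filter_upwards [hcurve.eventually hev] with ψ' hψ'
    exact hψ'
  exact (hasDerivAt_apply_conj_circleDiagonal_curve L N α w Θ hΘ z₀ c g ψ).unique ((hasDerivAt_const ψ (0 : E)).congr_of_eventuallyEq hev')

/-- **Joint continuity of the derivative term** `(ψ, g) ↦ DΘ(↑↑(g·t_w(z_ψ)·g⁻¹))[↑g · diag d′(ψ) · ↑g⁻¹]` on `ℝ × G_w`. [cite: Folland1995, §2.6] -/
theorem continuous_fderiv_apply_conj_circleDiagonal_curve (Θ : Matrix (Fin N) (Fin N) ℂ → E) (hΘ : ContDiff ℝ 1 Θ) (z₀ : Fin N → Circle) (c : Fin N → ℝ) :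
    Continuous fun p : ℝ × archLocal L N (Matrix.diagonal α) w =>
      fderiv ℝ Θ ((((p.2 * ⟨circleDiagonal N fun i => z₀ i * Circle.exp (c i * p.1), circleDiagonal_mem_archLocal_diagonal L N α w _⟩ * p.2⁻¹ :
          archLocal L N (Matrix.diagonal α) w) : GL (Fin N) ℂ) : Matrix (Fin N) (Fin N) ℂ))
        (((p.2 : GL (Fin N) ℂ) : Matrix (Fin N) (Fin N) ℂ) * (Matrix.diagonal fun i => (z₀ i : ℂ) * (Complex.exp ((c i * p.1 : ℝ) * Complex.I) * ((c i : ℂ) * Complex.I))) *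
          (((p.2⁻¹ : archLocal L N (Matrix.diagonal α) w) : GL (Fin N) ℂ) : Matrix (Fin N) (Fin N) ℂ)) := by
  have ht : Continuous fun ψ' : ℝ => (⟨circleDiagonal N fun i => z₀ i * Circle.exp (c i * ψ'), circleDiagonal_mem_archLocal_diagonal L N α w _⟩ :
      archLocal L N (Matrix.diagonal α) w) :=
    ((continuous_circleDiagonal N).comp (continuous_torusCurve z₀ c)).subtype_mk _
  have hpt : Continuous fun p : ℝ × archLocal L N (Matrix.diagonal α) w => ((((p.2 * ⟨circleDiagonal N fun i => z₀ i * Circle.exp (c i * p.1),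
      circleDiagonal_mem_archLocal_diagonal L N α w _⟩ * p.2⁻¹ : archLocal L N (Matrix.diagonal α) w) : GL (Fin N) ℂ) : Matrix (Fin N) (Fin N) ℂ)) :=
    (Units.continuous_val.comp continuous_subtype_val).comp ((continuous_snd.mul (ht.comp continuous_fst)).mul continuous_snd.inv)
  have hd'cont : Continuous fun ψ : ℝ => (Matrix.diagonal fun i => (z₀ i : ℂ) * (Complex.exp ((c i * ψ : ℝ) * Complex.I) * ((c i : ℂ) * Complex.I))) := by
    refine (LinearMap.toContinuousLinearMap (Matrix.diagonalLinearMap (Fin N) ℝ ℂ)).continuous.comp ?_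
    refine continuous_pi fun i => ?_
    exact continuous_const.mul (((Complex.continuous_ofReal.comp (continuous_const.mul continuous_id)).mul continuous_const).cexp.mul continuous_const)
  have hdir : Continuous fun p : ℝ × archLocal L N (Matrix.diagonal α) w => ((p.2 : GL (Fin N) ℂ) : Matrix (Fin N) (Fin N) ℂ) *
      (Matrix.diagonal fun i => (z₀ i : ℂ) * (Complex.exp ((c i * p.1 : ℝ) * Complex.I) * ((c i : ℂ) * Complex.I))) *
      (((p.2⁻¹ : archLocal L N (Matrix.diagonal α) w) : GL (Fin N) ℂ) : Matrix (Fin N) (Fin N) ℂ) :=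
    (((Units.continuous_val.comp continuous_subtype_val).comp continuous_snd).mul (hd'cont.comp continuous_fst)).mul
      ((Units.continuous_val.comp continuous_subtype_val).comp continuous_snd.inv)
  exact ((hΘ.continuous_fderiv one_ne_zero).comp hpt).clm_apply hdir

/-! ## §2 Differentiation under the integral sign on the BLOCK-SEPARATED set (constant-sign blocks; through compact walls) -/

/-- **A block-separated parameter has a closed ball of block-separated parameters around it, off a COMPACT subset of `G_w` of which the derivative term vanishes on
the whole ball** (★ `isOpen_setOf_blockSeparated`; ★ (C-cw) `isCompact_setOf_exists_conj_circleDiagonal_mem_of_blocks` for the compact curve image of the ball; §1).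
[cite: Rogawski1990, §8.2 pp. 122–123] [cite: DeitmarEchterhoff2014, Lemma 9.3.3] -/
theorem exists_closedBall_isCompact_fderiv_apply_conj_circleDiagonal_curve_eq_zero_of_blocks (hα : ∀ i, α i ≠ 0)
    (hreal : ∀ i, (w.1.embedding (α i)).im = 0) {ι : Type*} (b : Fin N → ι)
    (hsign : ∀ i j, i ≠ j → b i = b j → 0 < (w.1.embedding (α i)).re * (w.1.embedding (α j)).re)
    (Θ : Matrix (Fin N) (Fin N) ℂ → E) (hΘ : ContDiff ℝ 1 Θ)
    (hfc : HasCompactSupport fun k : archLocal L N (Matrix.diagonal α) w => Θ (((k : GL (Fin N) ℂ) : Matrix (Fin N) (Fin N) ℂ)))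
    (z₀ : Fin N → Circle) (c : Fin N → ℝ) (ψ₀ : ℝ) (hψ₀ : ∀ i j, b i ≠ b j → z₀ i * Circle.exp (c i * ψ₀) ≠ z₀ j * Circle.exp (c j * ψ₀)) :
    ∃ δ : ℝ, 0 < δ ∧ (∀ ψ ∈ Metric.closedBall ψ₀ δ, ∀ i j, b i ≠ b j → z₀ i * Circle.exp (c i * ψ) ≠ z₀ j * Circle.exp (c j * ψ)) ∧
      ∃ S : Set (archLocal L N (Matrix.diagonal α) w), IsCompact S ∧ ∀ g ∉ S, ∀ ψ ∈ Metric.closedBall ψ₀ δ,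
        fderiv ℝ Θ ((((g * ⟨circleDiagonal N fun i => z₀ i * Circle.exp (c i * ψ), circleDiagonal_mem_archLocal_diagonal L N α w _⟩ * g⁻¹ :
            archLocal L N (Matrix.diagonal α) w) : GL (Fin N) ℂ) : Matrix (Fin N) (Fin N) ℂ))
          (((g : GL (Fin N) ℂ) : Matrix (Fin N) (Fin N) ℂ) * (Matrix.diagonal fun i => (z₀ i : ℂ) * (Complex.exp ((c i * ψ : ℝ) * Complex.I) * ((c i : ℂ) * Complex.I))) *
            (((g⁻¹ : archLocal L N (Matrix.diagonal α) w) : GL (Fin N) ℂ) : Matrix (Fin N) (Fin N) ℂ)) = 0 := by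
  have hzc_cont : Continuous fun ψ' : ℝ => fun i => z₀ i * Circle.exp (c i * ψ') := continuous_torusCurve z₀ c
  have hopen : IsOpen {z : Fin N → Circle | ∀ i j, b i ≠ b j → z i ≠ z j} := isOpen_setOf_blockSeparated b
  obtain ⟨δ, hδ, hball⟩ : ∃ δ > 0, Metric.closedBall ψ₀ δ ⊆
      (fun ψ' : ℝ => fun i => z₀ i * Circle.exp (c i * ψ')) ⁻¹' {z : Fin N → Circle | ∀ i j, b i ≠ b j → z i ≠ z j} := by
    obtain ⟨ε, hε, hεball⟩ := Metric.mem_nhds_iff.1 ((hopen.preimage hzc_cont).mem_nhds (show ψ₀ ∈ _ from hψ₀))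
    exact ⟨ε / 2, half_pos hε, (Metric.closedBall_subset_ball (half_lt_self hε)).trans hεball⟩
  have hKc : IsCompact ((fun ψ' : ℝ => fun i => z₀ i * Circle.exp (c i * ψ')) '' Metric.closedBall ψ₀ δ) :=
    (isCompact_closedBall ψ₀ δ).image hzc_cont
  have hKsep : (fun ψ' : ℝ => fun i => z₀ i * Circle.exp (c i * ψ')) '' Metric.closedBall ψ₀ δ ⊆ {z : Fin N → Circle | ∀ i j, b i ≠ b j → z i ≠ z j} := by
    rintro _ ⟨ψ, hψ, rfl⟩; exact hball hψ
  have hS := isCompact_setOf_exists_conj_circleDiagonal_mem_of_blocks L N α w hα hreal b hsign hKc hKsep hfc.isCompact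
  refine ⟨δ, hδ, fun ψ hψ => hball hψ, _, hS, fun g hg ψ hψ => ?_⟩
  exact fderiv_apply_conj_circleDiagonal_curve_eq_zero L N α w Θ hΘ z₀ c g ψ fun h => hg ⟨_, ⟨ψ, hψ, rfl⟩, h⟩

variable [MeasurableSpace (archLocal L N (Matrix.diagonal α) w)] [BorelSpace (archLocal L N (Matrix.diagonal α) w)]

/-- **THE PER-PLACE TORUS ORBITAL FUNCTION IS DIFFERENTIABLE ALONG THE ONE-ANGLE CURVES AT EVERY BLOCK-SEPARATED PARAMETER, WITH THE DERIVATIVE UNDER THE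
INTEGRAL SIGN** — `Θ` `C¹` on `M_N(ℂ)` with compact support on `G_w`, `ν` finite on compacta, `z_{ψ₀}` block-separated for a constant-sign labelling `b`:
`d∕dψ|_{ψ₀} ∫ Θ(↑↑(g·t_w(z_ψ)·g⁻¹)) dν(g) = ∫ DΘ(↑↑(g·t_w(z_{ψ₀})·g⁻¹))[↑g·diag d′(ψ₀)·↑g⁻¹] dν(g)` (and the latter integrand is integrable).  For `b` injective
this is the per-place twin of ★ `hasDerivAt_integral_comp_conj_archDiagTorus_curve`; for `b = (0, 1, 0)` on `U(2,1)` it differentiates THROUGH the compact wall.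
Dominated differentiation on the ball of the previous theorem, bound `1_S · max B 0`. [cite: Rogawski1990, §8.2 pp. 122–123] [cite: Shelstad1979, §4] [cite: Folland1995, §2.6] -/
theorem hasDerivAt_integral_comp_conj_circleDiagonal_curve_of_blocks (hα : ∀ i, α i ≠ 0) (hreal : ∀ i, (w.1.embedding (α i)).im = 0)
    {ι : Type*} (b : Fin N → ι) (hsign : ∀ i j, i ≠ j → b i = b j → 0 < (w.1.embedding (α i)).re * (w.1.embedding (α j)).re)
    (ν : Measure (archLocal L N (Matrix.diagonal α) w)) [IsFiniteMeasureOnCompacts ν]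
    (Θ : Matrix (Fin N) (Fin N) ℂ → E) (hΘ : ContDiff ℝ 1 Θ)
    (hfc : HasCompactSupport fun k : archLocal L N (Matrix.diagonal α) w => Θ (((k : GL (Fin N) ℂ) : Matrix (Fin N) (Fin N) ℂ)))
    (z₀ : Fin N → Circle) (c : Fin N → ℝ) (ψ₀ : ℝ) (hψ₀ : ∀ i j, b i ≠ b j → z₀ i * Circle.exp (c i * ψ₀) ≠ z₀ j * Circle.exp (c j * ψ₀)) :
    Integrable (fun g : archLocal L N (Matrix.diagonal α) w =>
      fderiv ℝ Θ ((((g * ⟨circleDiagonal N fun i => z₀ i * Circle.exp (c i * ψ₀), circleDiagonal_mem_archLocal_diagonal L N α w _⟩ * g⁻¹ :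
          archLocal L N (Matrix.diagonal α) w) : GL (Fin N) ℂ) : Matrix (Fin N) (Fin N) ℂ))
        (((g : GL (Fin N) ℂ) : Matrix (Fin N) (Fin N) ℂ) * (Matrix.diagonal fun i => (z₀ i : ℂ) * (Complex.exp ((c i * ψ₀ : ℝ) * Complex.I) * ((c i : ℂ) * Complex.I))) *
          (((g⁻¹ : archLocal L N (Matrix.diagonal α) w) : GL (Fin N) ℂ) : Matrix (Fin N) (Fin N) ℂ))) ν ∧
    HasDerivAt (fun ψ : ℝ => ∫ g : archLocal L N (Matrix.diagonal α) w,
        Θ ((((g * ⟨circleDiagonal N fun i => z₀ i * Circle.exp (c i * ψ), circleDiagonal_mem_archLocal_diagonal L N α w _⟩ * g⁻¹ :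
          archLocal L N (Matrix.diagonal α) w) : GL (Fin N) ℂ) : Matrix (Fin N) (Fin N) ℂ)) ∂ν)
      (∫ g : archLocal L N (Matrix.diagonal α) w,
        fderiv ℝ Θ ((((g * ⟨circleDiagonal N fun i => z₀ i * Circle.exp (c i * ψ₀), circleDiagonal_mem_archLocal_diagonal L N α w _⟩ * g⁻¹ :
            archLocal L N (Matrix.diagonal α) w) : GL (Fin N) ℂ) : Matrix (Fin N) (Fin N) ℂ))
          (((g : GL (Fin N) ℂ) : Matrix (Fin N) (Fin N) ℂ) * (Matrix.diagonal fun i => (z₀ i : ℂ) * (Complex.exp ((c i * ψ₀ : ℝ) * Complex.I) * ((c i : ℂ) * Complex.I))) *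
            (((g⁻¹ : archLocal L N (Matrix.diagonal α) w) : GL (Fin N) ℂ) : Matrix (Fin N) (Fin N) ℂ)) ∂ν) ψ₀ := by
  -- abbreviations: the integrand `F` and its `ψ`-derivative `F'`
  obtain ⟨F, hF⟩ : ∃ F : ℝ → archLocal L N (Matrix.diagonal α) w → E, F = fun ψ g =>
      Θ ((((g * ⟨circleDiagonal N fun i => z₀ i * Circle.exp (c i * ψ), circleDiagonal_mem_archLocal_diagonal L N α w _⟩ * g⁻¹ :
        archLocal L N (Matrix.diagonal α) w) : GL (Fin N) ℂ) : Matrix (Fin N) (Fin N) ℂ)) := ⟨_, rfl⟩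
  obtain ⟨F', hF'⟩ : ∃ F' : ℝ → archLocal L N (Matrix.diagonal α) w → E, F' = fun ψ g =>
      fderiv ℝ Θ ((((g * ⟨circleDiagonal N fun i => z₀ i * Circle.exp (c i * ψ), circleDiagonal_mem_archLocal_diagonal L N α w _⟩ * g⁻¹ :
          archLocal L N (Matrix.diagonal α) w) : GL (Fin N) ℂ) : Matrix (Fin N) (Fin N) ℂ))
        (((g : GL (Fin N) ℂ) : Matrix (Fin N) (Fin N) ℂ) * (Matrix.diagonal fun i => (z₀ i : ℂ) * (Complex.exp ((c i * ψ : ℝ) * Complex.I) * ((c i : ℂ) * Complex.I))) *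
          (((g⁻¹ : archLocal L N (Matrix.diagonal α) w) : GL (Fin N) ℂ) : Matrix (Fin N) (Fin N) ℂ)) := ⟨_, rfl⟩
  -- (1) pointwise derivatives and joint continuity of `F'`
  have hderiv : ∀ g ψ, HasDerivAt (fun ψ => F ψ g) (F' ψ g) ψ := fun g ψ => by
    rw [hF, hF']
    exact hasDerivAt_apply_conj_circleDiagonal_curve L N α w Θ hΘ z₀ c g ψ
  have hF'cont : Continuous (Function.uncurry F') := by
    rw [hF']
    exact continuous_fderiv_apply_conj_circleDiagonal_curve L N α w Θ hΘ z₀ c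
  have hfcont : Continuous fun k : archLocal L N (Matrix.diagonal α) w => Θ (((k : GL (Fin N) ℂ) : Matrix (Fin N) (Fin N) ℂ)) :=
    hΘ.continuous.comp (Units.continuous_val.comp continuous_subtype_val)
  -- (2) the ball of block-separated parameters and the compact set carrying `F'`
  obtain ⟨δ, hδ, hballsep, S, hSc, hS⟩ :=
    exists_closedBall_isCompact_fderiv_apply_conj_circleDiagonal_curve_eq_zero_of_blocks L N α w hα hreal b hsign Θ hΘ hfc z₀ c ψ₀ hψ₀
  have hF'zero : ∀ g, g ∉ S → ∀ ψ ∈ Metric.closedBall ψ₀ δ, F' ψ g = 0 := fun g hg ψ hψ => by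
    rw [hF']
    exact hS g hg ψ hψ
  -- (3) a uniform bound on `closedBall × S` and the domination
  obtain ⟨B, hB⟩ := ((isCompact_closedBall ψ₀ δ).prod hSc).exists_bound_of_continuousOn hF'cont.continuousOn
  have h_bound : ∀ᵐ g ∂ν, ∀ ψ ∈ Metric.ball ψ₀ δ, ‖F' ψ g‖ ≤ S.indicator (fun _ => max B 0) g := by
    refine Eventually.of_forall fun g ψ hψ => ?_
    have hψ' : ψ ∈ Metric.closedBall ψ₀ δ := Metric.ball_subset_closedBall hψ
    by_cases hg : g ∈ S
    · rw [Set.indicator_of_mem hg]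
      exact (hB (ψ, g) ⟨hψ', hg⟩).trans (le_max_left _ _)
    · rw [hF'zero g hg ψ hψ', norm_zero, Set.indicator_of_notMem hg]
  have hbound_int : Integrable (S.indicator fun _ => max B 0) ν :=
    IntegrableOn.integrable_indicator (integrableOn_const (hSc.measure_lt_top.ne)) hSc.measurableSet
  -- (4) measurability ∕ integrability at `ψ₀`, and the dominated differentiation theorem
  have hF_meas : ∀ᶠ ψ in 𝓝 ψ₀, AEStronglyMeasurable (F ψ) ν := by
    filter_upwards [Metric.closedBall_mem_nhds ψ₀ hδ] with ψ hψ
    rw [hF]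
    exact ((hfcont.comp ((continuous_id.mul continuous_const).mul continuous_id.inv)).stronglyMeasurable_of_hasCompactSupport
      (hasCompactSupport_comp_conj_circleDiagonal_of_blocks L N α w hα hreal b hsign (hballsep ψ hψ)
        (fun k : archLocal L N (Matrix.diagonal α) w => Θ (((k : GL (Fin N) ℂ) : Matrix (Fin N) (Fin N) ℂ))) hfc)).aestronglyMeasurable
  have hF_int : Integrable (F ψ₀) ν := by
    rw [hF]
    exact integrable_comp_conj_circleDiagonal_of_blocks L N α w hα hreal b hsign ν hψ₀
      (fun k : archLocal L N (Matrix.diagonal α) w => Θ (((k : GL (Fin N) ℂ) : Matrix (Fin N) (Fin N) ℂ))) hfcont hfc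
  have hF'_meas : AEStronglyMeasurable (F' ψ₀) ν :=
    ((hF'cont.comp (continuous_const.prodMk continuous_id)).stronglyMeasurable_of_hasCompactSupport
      (HasCompactSupport.intro hSc fun g hg => hF'zero g hg ψ₀ (Metric.mem_closedBall_self hδ.le))).aestronglyMeasurable
  have h_diff : ∀ᵐ g ∂ν, ∀ ψ ∈ Metric.ball ψ₀ δ, HasDerivAt (fun ψ => F ψ g) (F' ψ g) ψ :=
    Eventually.of_forall fun g ψ _ => hderiv g ψ
  have hmain := hasDerivAt_integral_of_dominated_loc_of_deriv_le (Metric.ball_mem_nhds ψ₀ hδ) hF_meas hF_int hF'_meas h_bound hbound_int h_diff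
  rw [hF, hF'] at hmain
  exact hmain

/-- **The derivative term integrates to a function continuous on the block-separated parameter set** (locally the integrand is jointly continuous and carried by a
fixed compact set: Mathlib `continuousOn_integral_of_compact_support`). [cite: Rogawski1990, §8.2 pp. 122–123] [cite: Shelstad1979, §4] -/
theorem continuousOn_integral_fderiv_apply_conj_circleDiagonal_curve_of_blocks (hα : ∀ i, α i ≠ 0) (hreal : ∀ i, (w.1.embedding (α i)).im = 0)
    {ι : Type*} (b : Fin N → ι) (hsign : ∀ i j, i ≠ j → b i = b j → 0 < (w.1.embedding (α i)).re * (w.1.embedding (α j)).re)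
    (ν : Measure (archLocal L N (Matrix.diagonal α) w)) [IsFiniteMeasureOnCompacts ν]
    (Θ : Matrix (Fin N) (Fin N) ℂ → E) (hΘ : ContDiff ℝ 1 Θ)
    (hfc : HasCompactSupport fun k : archLocal L N (Matrix.diagonal α) w => Θ (((k : GL (Fin N) ℂ) : Matrix (Fin N) (Fin N) ℂ)))
    (z₀ : Fin N → Circle) (c : Fin N → ℝ) :
    ContinuousOn (fun ψ : ℝ => ∫ g : archLocal L N (Matrix.diagonal α) w,
        fderiv ℝ Θ ((((g * ⟨circleDiagonal N fun i => z₀ i * Circle.exp (c i * ψ), circleDiagonal_mem_archLocal_diagonal L N α w _⟩ * g⁻¹ :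
            archLocal L N (Matrix.diagonal α) w) : GL (Fin N) ℂ) : Matrix (Fin N) (Fin N) ℂ))
          (((g : GL (Fin N) ℂ) : Matrix (Fin N) (Fin N) ℂ) * (Matrix.diagonal fun i => (z₀ i : ℂ) * (Complex.exp ((c i * ψ : ℝ) * Complex.I) * ((c i : ℂ) * Complex.I))) *
            (((g⁻¹ : archLocal L N (Matrix.diagonal α) w) : GL (Fin N) ℂ) : Matrix (Fin N) (Fin N) ℂ)) ∂ν)
      {ψ : ℝ | ∀ i j, b i ≠ b j → z₀ i * Circle.exp (c i * ψ) ≠ z₀ j * Circle.exp (c j * ψ)} := by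
  intro ψ₀ hψ₀
  obtain ⟨δ, hδ, -, S, hSc, hS⟩ :=
    exists_closedBall_isCompact_fderiv_apply_conj_circleDiagonal_curve_eq_zero_of_blocks L N α w hα hreal b hsign Θ hΘ hfc z₀ c ψ₀ hψ₀
  have hcont : ContinuousOn (fun ψ : ℝ => ∫ g : archLocal L N (Matrix.diagonal α) w,
      fderiv ℝ Θ ((((g * ⟨circleDiagonal N fun i => z₀ i * Circle.exp (c i * ψ), circleDiagonal_mem_archLocal_diagonal L N α w _⟩ * g⁻¹ :
          archLocal L N (Matrix.diagonal α) w) : GL (Fin N) ℂ) : Matrix (Fin N) (Fin N) ℂ))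
        (((g : GL (Fin N) ℂ) : Matrix (Fin N) (Fin N) ℂ) * (Matrix.diagonal fun i => (z₀ i : ℂ) * (Complex.exp ((c i * ψ : ℝ) * Complex.I) * ((c i : ℂ) * Complex.I))) *
          (((g⁻¹ : archLocal L N (Matrix.diagonal α) w) : GL (Fin N) ℂ) : Matrix (Fin N) (Fin N) ℂ)) ∂ν) (Metric.closedBall ψ₀ δ) :=
    continuousOn_integral_of_compact_support hSc (continuous_fderiv_apply_conj_circleDiagonal_curve L N α w Θ hΘ z₀ c).continuousOn
      fun ψ g hψ hg => hS g hg ψ hψ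
  exact (hcont.continuousAt (Metric.closedBall_mem_nhds ψ₀ hδ)).continuousWithinAt

/-- **The derivative of the torus orbital function along the curve at a block-separated parameter** (`hasDerivAt_…_of_blocks`). [cite: Rogawski1990, §8.2 pp. 122–123] -/
theorem deriv_integral_comp_conj_circleDiagonal_curve_of_blocks (hα : ∀ i, α i ≠ 0) (hreal : ∀ i, (w.1.embedding (α i)).im = 0)
    {ι : Type*} (b : Fin N → ι) (hsign : ∀ i j, i ≠ j → b i = b j → 0 < (w.1.embedding (α i)).re * (w.1.embedding (α j)).re)
    (ν : Measure (archLocal L N (Matrix.diagonal α) w)) [IsFiniteMeasureOnCompacts ν]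
    (Θ : Matrix (Fin N) (Fin N) ℂ → E) (hΘ : ContDiff ℝ 1 Θ)
    (hfc : HasCompactSupport fun k : archLocal L N (Matrix.diagonal α) w => Θ (((k : GL (Fin N) ℂ) : Matrix (Fin N) (Fin N) ℂ)))
    (z₀ : Fin N → Circle) (c : Fin N → ℝ) (ψ₀ : ℝ) (hψ₀ : ∀ i j, b i ≠ b j → z₀ i * Circle.exp (c i * ψ₀) ≠ z₀ j * Circle.exp (c j * ψ₀)) :
    deriv (fun ψ : ℝ => ∫ g : archLocal L N (Matrix.diagonal α) w,
        Θ ((((g * ⟨circleDiagonal N fun i => z₀ i * Circle.exp (c i * ψ), circleDiagonal_mem_archLocal_diagonal L N α w _⟩ * g⁻¹ :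
          archLocal L N (Matrix.diagonal α) w) : GL (Fin N) ℂ) : Matrix (Fin N) (Fin N) ℂ)) ∂ν) ψ₀ =
      ∫ g : archLocal L N (Matrix.diagonal α) w,
        fderiv ℝ Θ ((((g * ⟨circleDiagonal N fun i => z₀ i * Circle.exp (c i * ψ₀), circleDiagonal_mem_archLocal_diagonal L N α w _⟩ * g⁻¹ :
            archLocal L N (Matrix.diagonal α) w) : GL (Fin N) ℂ) : Matrix (Fin N) (Fin N) ℂ))
          (((g : GL (Fin N) ℂ) : Matrix (Fin N) (Fin N) ℂ) * (Matrix.diagonal fun i => (z₀ i : ℂ) * (Complex.exp ((c i * ψ₀ : ℝ) * Complex.I) * ((c i : ℂ) * Complex.I))) *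
            (((g⁻¹ : archLocal L N (Matrix.diagonal α) w) : GL (Fin N) ℂ) : Matrix (Fin N) (Fin N) ℂ)) ∂ν :=
  (hasDerivAt_integral_comp_conj_circleDiagonal_curve_of_blocks L N α w hα hreal b hsign ν Θ hΘ hfc z₀ c ψ₀ hψ₀).2.deriv

/-- **THE PER-PLACE TORUS ORBITAL FUNCTION IS `C¹` ALONG THE ONE-ANGLE CURVES ON THE BLOCK-SEPARATED PARAMETER SET** `{ψ | z_ψ block-separated}` (open) — through every
compact wall inside a constant-sign block. [cite: Rogawski1990, §8.2 pp. 122–123] [cite: Shelstad1979, §4] [cite: Folland1995, §2.6] -/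
theorem contDiffOn_one_integral_comp_conj_circleDiagonal_curve_of_blocks (hα : ∀ i, α i ≠ 0) (hreal : ∀ i, (w.1.embedding (α i)).im = 0)
    {ι : Type*} (b : Fin N → ι) (hsign : ∀ i j, i ≠ j → b i = b j → 0 < (w.1.embedding (α i)).re * (w.1.embedding (α j)).re)
    (ν : Measure (archLocal L N (Matrix.diagonal α) w)) [IsFiniteMeasureOnCompacts ν]
    (Θ : Matrix (Fin N) (Fin N) ℂ → E) (hΘ : ContDiff ℝ 1 Θ)
    (hfc : HasCompactSupport fun k : archLocal L N (Matrix.diagonal α) w => Θ (((k : GL (Fin N) ℂ) : Matrix (Fin N) (Fin N) ℂ)))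
    (z₀ : Fin N → Circle) (c : Fin N → ℝ) :
    ContDiffOn ℝ 1 (fun ψ : ℝ => ∫ g : archLocal L N (Matrix.diagonal α) w,
        Θ ((((g * ⟨circleDiagonal N fun i => z₀ i * Circle.exp (c i * ψ), circleDiagonal_mem_archLocal_diagonal L N α w _⟩ * g⁻¹ :
          archLocal L N (Matrix.diagonal α) w) : GL (Fin N) ℂ) : Matrix (Fin N) (Fin N) ℂ)) ∂ν)
      {ψ : ℝ | ∀ i j, b i ≠ b j → z₀ i * Circle.exp (c i * ψ) ≠ z₀ j * Circle.exp (c j * ψ)} := by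
  have hzc_cont : Continuous fun ψ' : ℝ => fun i => z₀ i * Circle.exp (c i * ψ') := continuous_torusCurve z₀ c
  have hU : IsOpen {ψ : ℝ | ∀ i j, b i ≠ b j → z₀ i * Circle.exp (c i * ψ) ≠ z₀ j * Circle.exp (c j * ψ)} :=
    (isOpen_setOf_blockSeparated b).preimage hzc_cont
  rw [show (1 : WithTop ℕ∞) = 0 + 1 from rfl, contDiffOn_succ_iff_deriv_of_isOpen hU]
  refine ⟨fun ψ₀ hψ₀ => (hasDerivAt_integral_comp_conj_circleDiagonal_curve_of_blocks L N α w hα hreal b hsign ν Θ hΘ hfc z₀ c ψ₀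
      hψ₀).2.differentiableAt.differentiableWithinAt, fun h => (WithTop.zero_ne_top h).elim, ?_⟩
  rw [contDiffOn_zero]
  refine (continuousOn_integral_fderiv_apply_conj_circleDiagonal_curve_of_blocks L N α w hα hreal b hsign ν Θ hΘ hfc z₀ c).congr fun ψ₀ hψ₀ => ?_
  exact deriv_integral_comp_conj_circleDiagonal_curve_of_blocks L N α w hα hreal b hsign ν Θ hΘ hfc z₀ c ψ₀ hψ₀

end Literature.NumberTheory.Automorphic.UnitaryGroup

end
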